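import Summits.NavierStokesRegularity.FluidComputer.LipschitzRowWeakClock
import Summits.NavierStokesRegularity.FluidComputer.EulerFace
import HarnessLib

/-!
# Fluid computer — EULER FACE, row E2′: Chae's threshold IN LEVEL CURRENCY for the Euler controls —
# `limsup_{t↑T} (T − t)·∑_l 2^l ‖Δ̇_l u(t)‖_∞ ≥ 1/C_L`

HONEST FRAMING (cell `pub-fluidc`, verbatim): *low prior, high value-of-information experiment on Tao's
machine paradigm; NOT a claim that NS blows up.* Theorem side of the cell (the level dictionary); nothing here is
evidence of blow-up.

Row E2 (`EulerFace.euler_typeI_threshold`, Chae 2010 Thm. 1.1): at a genuine blow-up of a maximal classical Euler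
solution of the Beale–Kato–Majda class, `(T − t)·sup_x ‖∇u(t, x)‖` exceeds every `M₀ < 1` arbitrarily close to `T`.
Row L63′ (`LipschitzRowWeakClock`) translated the viscous twin L63 into the dictionary's level currency through the
Littlewood–Paley reconstruction of the gradient (`exists_iSup_fderiv_le_lipschitzRow`:
`sup_x ‖∇v(x)‖ ≤ C_L ∑_l 2^l ‖Δ̇_l v‖_∞` for smooth `L²` fields, absolute `C_L`). The slices of an Euler solution of the
class are smooth `L²` fields (`SummedOccupationBridge.isSmoothL2Field_slice`, any `ν`), so the same translation holds
for the EULER controls. Class: maximal classical Euler solutions `(u, p)` on `ℝ³ × [0, T)`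
(`IsMaximalSmoothSolution 0 0 u p T`) with all Sobolev norms bounded on every closed sub-slab
(`HasBoundedSobolevNormsOn (Icc 0 T'') u`, `T'' < T` — carried as a hypothesis, as in E1–E2):

* `euler_lipschitzRow_weak_clock` (**E2′**): with the constant `C_L` of `exists_iSup_fderiv_le_lipschitzRow`, for every
  `M₀ < 1` and every `t₀ ∈ [0, T)` some `t ∈ [t₀, T)` has `M₀/(T − t) < C_L · ∑_l 2^l ‖Δ̇_l u(t)‖_∞` —
  `limsup_{t↑T} (T − t)·∑_l 2^l s_l(t) ≥ 1/C_L`;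
* `euler_lipschitzRow_weak_clock_frequently` — filter form;
* `euler_face'` — E1 ∧ E2 ∧ E2′ assembled.

Reading for the machine paradigm: for the inviscid runs too, the `2^l`-weighted row of block sups — the Lipschitz budget
of the cascade — must return to the self-similar level `≈ 1/(T − t)` again and again before an extrapolated singular
time `T`; a design on which `(T − t)·∑_l 2^l s_l(t)` decays to `0` is not approaching an Euler singularity at that `T`.
HONEST: `C_L` inexplicit (Littlewood–Paley constants); weak form only; the class hypothesis is NOT discharged for Euler
(no `H^∞` persistence theorem for Euler in the tree is invoked — it is the Beale–Kato–Majda class by assumption).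
Necessity only. 0 sorry; no definitions; no named facts.

## References

* D. Chae, J. Funct. Anal. 258 (2010) 2865–2883 = arXiv:0711.1113, Thm. 1.1. [Chae2010]
* J. T. Beale, T. Kato, A. Majda, Comm. Math. Phys. 94 (1984) 61–66, Thm. 1. [BealeKatoMajda1984]
* H. Bahouri, J.-Y. Chemin, R. Danchin, Grundlehren 343 (2011), Lemma 2.1, Prop. 2.12. [BahouriCheminDanchin2011]
-/

noncomputable section

open MeasureTheory Set Function Filter Topology Metric
open scoped ENNReal NNReal
open Literature.Analysis.FluidPDE Literature.Analysis.FunctionSpaces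
open Summit.NavierStokesRegularity.FluidComputer.SummedOccupationBridge (isSmoothL2Field_slice)
open Summit.NavierStokesRegularity.FluidComputer.LipschitzRowWeakClock
open Summit.NavierStokesRegularity.FluidComputer.EulerFace

namespace Summit.NavierStokesRegularity.FluidComputer.EulerLipschitzRowFace

/-! ## E2′: Chae's threshold in level currency -/

/-- **E2′ — THE LIPSCHITZ ROW OF AN EULER BLOW-UP MUST REACH `1/(C_L (T − t))` ARBITRARILY CLOSE TO `T`.** With the
absolute constant `C_L` of `exists_iSup_fderiv_le_lipschitzRow`: for every maximal classical Euler solution `(u, p)` on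
`ℝ³ × [0, T)` (`T > 0`) in the Beale–Kato–Majda class on every closed sub-slab, every `M₀ < 1` and every
`t₀ ∈ [0, T)`, some `t ∈ [t₀, T)` has `M₀/(T − t) < C_L · ∑_l 2^l ‖Δ̇_l u(t)‖_∞` (E2 `euler_typeI_threshold` read through
`sup_x ‖∇u(t, x)‖ ≤ C_L ∑_l 2^l ‖Δ̇_l u(t)‖_∞` on the smooth `L²` slice `u(t)`). Necessity only; weak form; class
hypothesis carried. [cite: Chae2010, Thm 1.1] [cite: BahouriCheminDanchin2011, Lemma 2.1 and Prop. 2.12] -/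
theorem euler_lipschitzRow_weak_clock {T : ℝ} (hT : 0 < T)
    {u : ℝ → EuclideanSpace ℝ (Fin 3) → EuclideanSpace ℝ (Fin 3)} {p : ℝ → EuclideanSpace ℝ (Fin 3) → ℝ}
    (hmax : IsMaximalSmoothSolution 0 0 u p T) (hreg : ∀ T'' < T, HasBoundedSobolevNormsOn (Icc 0 T'') u)
    {M₀ : ℝ} (hM₀ : M₀ < 1) {t₀ : ℝ} (ht₀ : t₀ ∈ Ico 0 T) :
    ∃ t ∈ Ico t₀ T,
      ENNReal.ofReal (M₀ / (T - t)) <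
        exists_iSup_fderiv_le_lipschitzRow.choose * ∑' j : ℤ, (2 : ℝ≥0∞) ^ j * blockSup (u t) j := by
  have hCL := exists_iSup_fderiv_le_lipschitzRow.choose_spec
  set CL : ℝ≥0 := exists_iSup_fderiv_le_lipschitzRow.choose with hCLdef
  -- a non-negative threshold `M₁ = max M₀ 0 < 1`
  set M₁ : ℝ := max M₀ 0 with hM₁
  have hM₁1 : M₁ < 1 := max_lt hM₀ one_pos
  have hM₁0 : 0 ≤ M₁ := le_max_right _ _
  obtain ⟨t, ht, x, hx⟩ := euler_typeI_threshold hT hmax hreg hM₁1 ht₀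
  refine ⟨t, ht, ?_⟩
  have hTt : 0 < T - t := sub_pos.2 ht.2
  have hsm : IsSmoothL2Field (u t) := isSmoothL2Field_slice hmax.1 hreg ⟨ht₀.1.trans ht.1, ht.2⟩
  have h1 : M₁ / (T - t) < ‖fderiv ℝ (u t) x‖ := by
    rw [div_lt_iff₀ hTt]
    linarith
  have h1pos : 0 < ‖fderiv ℝ (u t) x‖ := lt_of_le_of_lt (div_nonneg hM₁0 hTt.le) h1
  have h0 : M₀ / (T - t) ≤ M₁ / (T - t) := div_le_div_of_nonneg_right (le_max_left _ _) hTt.le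
  calc ENNReal.ofReal (M₀ / (T - t)) ≤ ENNReal.ofReal (M₁ / (T - t)) := ENNReal.ofReal_le_ofReal h0
    _ < ‖fderiv ℝ (u t) x‖ₑ := by
        rw [← ofReal_norm]
        exact (ENNReal.ofReal_lt_ofReal_iff h1pos).2 h1
    _ ≤ ⨆ y : EuclideanSpace ℝ (Fin 3), ‖fderiv ℝ (u t) y‖ₑ := le_iSup (fun y => ‖fderiv ℝ (u t) y‖ₑ) x
    _ ≤ CL * ∑' j : ℤ, (2 : ℝ≥0∞) ^ j * blockSup (u t) j := hCL (u t) hsm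

/-- **E2′, filter form**: with the constant `C_L` of `exists_iSup_fderiv_le_lipschitzRow`, along every maximal classical
Euler solution of the Beale–Kato–Majda class on `ℝ³ × [0, T)` (`T > 0`), for every `M₀ < 1`:
`∃ᶠ t in 𝓝[<] T, M₀/(T − t) < C_L · ∑_l 2^l ‖Δ̇_l u(t)‖_∞`. [cite: Chae2010, Thm 1.1] -/
theorem euler_lipschitzRow_weak_clock_frequently {T : ℝ} (hT : 0 < T)
    {u : ℝ → EuclideanSpace ℝ (Fin 3) → EuclideanSpace ℝ (Fin 3)} {p : ℝ → EuclideanSpace ℝ (Fin 3) → ℝ}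
    (hmax : IsMaximalSmoothSolution 0 0 u p T) (hreg : ∀ T'' < T, HasBoundedSobolevNormsOn (Icc 0 T'') u)
    {M₀ : ℝ} (hM₀ : M₀ < 1) :
    ∃ᶠ t in 𝓝[<] T, ENNReal.ofReal (M₀ / (T - t)) <
      exists_iSup_fderiv_le_lipschitzRow.choose * ∑' j : ℤ, (2 : ℝ≥0∞) ^ j * blockSup (u t) j := by
  rw [Filter.frequently_iff]
  intro U hU
  obtain ⟨l, hl, hlU⟩ := mem_nhdsLT_iff_exists_Ioo_subset.1 hU
  set t₀ : ℝ := (max l 0 + T) / 2 with ht₀def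
  have hm : max l 0 < T := max_lt hl hT
  have ht₀ : t₀ ∈ Ico 0 T := ⟨by rw [ht₀def]; linarith [le_max_right l 0], by rw [ht₀def]; linarith⟩
  have hlt₀ : l < t₀ := by rw [ht₀def]; linarith [le_max_left l 0]
  obtain ⟨t, ht, hx⟩ := euler_lipschitzRow_weak_clock hT hmax hreg hM₀ ht₀
  exact ⟨t, hlU ⟨hlt₀.trans_le ht.1, ht.2⟩, hx⟩

/-- **THE EULER FACE WITH E2′, ASSEMBLED**: a maximal classical Euler solution in the Beale–Kato–Majda class on closed
sub-slabs has, on every terminal window, (E1) a divergent BKM integral, (E2) `(T − t)‖∇u‖_∞` exceeding every `M₀ < 1`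
somewhere, and (E2′) the Lipschitz row `∑_l 2^l s_l` exceeding `M₀/(C_L(T − t))` somewhere.
[cite: BealeKatoMajda1984, Thm. 1] [cite: Chae2010, Thm 1.1] -/
theorem euler_face' {T : ℝ} (hT : 0 < T)
    {u : ℝ → EuclideanSpace ℝ (Fin 3) → EuclideanSpace ℝ (Fin 3)} {p : ℝ → EuclideanSpace ℝ (Fin 3) → ℝ}
    (hmax : IsMaximalSmoothSolution 0 0 u p T) (hreg : ∀ T'' < T, HasBoundedSobolevNormsOn (Icc 0 T'') u) :
    (∀ t₀ ∈ Ico 0 T, (∫⁻ t in Ioo t₀ T, ⨆ x, ‖curl (u t) x‖ₑ) = ∞) ∧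
      (∀ M₀ : ℝ, M₀ < 1 → ∀ t₀ ∈ Ico 0 T,
        ∃ t ∈ Ico t₀ T, ∃ x : EuclideanSpace ℝ (Fin 3), M₀ < (T - t) * ‖fderiv ℝ (u t) x‖) ∧
      ∀ M₀ : ℝ, M₀ < 1 → ∀ t₀ ∈ Ico 0 T, ∃ t ∈ Ico t₀ T,
        ENNReal.ofReal (M₀ / (T - t)) <
          exists_iSup_fderiv_le_lipschitzRow.choose * ∑' j : ℤ, (2 : ℝ≥0∞) ^ j * blockSup (u t) j :=
  ⟨fun _ ht₀ => euler_bkm_window hT hmax hreg ht₀, fun _ hM₀ _ ht₀ => euler_typeI_threshold hT hmax hreg hM₀ ht₀,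
    fun _ hM₀ _ ht₀ => euler_lipschitzRow_weak_clock hT hmax hreg hM₀ ht₀⟩

end Summit.NavierStokesRegularity.FluidComputer.EulerLipschitzRowFace

end
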